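import Literature.LinearAlgebra.Matrix.IntRowCertificate
import HarnessLib

/-!
# Integer row-operation certificates with unit pivots: `rank ≥ n` in EVERY characteristic

Topic `Literature/LinearAlgebra/Matrix`; a trunk-independent tool, a companion of
`IntRowCertificate.lean`.  There, a successful Boolean check `intTriCheck n A rows piv` (sparse
integer row combinations of an integer matrix that are lower-triangular on chosen pivot columns with
non-zero integer diagonal) yields `n ≤ rank M` over fields of characteristic ZERO only, because a
non-zero integer pivot may vanish modulo `p`.  When every diagonal value is `1` or `-1` — which exact
fraction-free elimination of a `0/±1` matrix very often achieves, and which all certificates of the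
first clients happen to satisfy — the same certificate is valid over EVERY field: the strengthened
check `intTriCheckUnit` additionally tests `|diagonal value| = 1`, and `le_rank_of_intTriCheckUnit`
transports it to `n ≤ rank (M.map Int.cast : Matrix m κ F)` for an arbitrary field `F`.
Everything here is PROVED. [folklore]

First client: the 111-equation certificates of
`Computability/AlgebraicComplexity/OneOneOneCensusCertificates.lean` (border-rank lower bounds for
small support tensors), upgraded from characteristic zero to all fields.
-/

namespace Literature.LinearAlgebra.Matrix

open _root_.Matrix

/-- The unit-pivot certificate test: `intTriCheck` and, in addition, every diagonal value
`intCertVal A rows piv a a` (`a < n`) has absolute value `1`. [folklore] -/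
def intTriCheckUnit (n : ℕ) (A : ℕ → ℕ → ℤ) (rows : List (List (ℕ × ℤ))) (piv : List ℕ) : Bool :=
  intTriCheck n A rows piv &&
    (List.range n).all fun a => (intCertVal A rows piv a a).natAbs == 1

/-- What a successful unit-pivot check says. [folklore] -/
theorem intTriCheckUnit_spec {n : ℕ} {A : ℕ → ℕ → ℤ} {rows : List (List (ℕ × ℤ))} {piv : List ℕ}
    (h : intTriCheckUnit n A rows piv = true) :
    intTriCheck n A rows piv = true ∧ ∀ a, a < n → (intCertVal A rows piv a a).natAbs = 1 := by
  unfold intTriCheckUnit at h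
  rw [Bool.and_eq_true] at h
  refine ⟨h.1, fun a ha => ?_⟩
  have h2 := h.2
  rw [List.all_eq_true] at h2
  simpa using h2 a (List.mem_range.2 ha)

/-- A unit-pivot check implies the plain check (so the characteristic-zero lemma still applies).
[folklore] -/
theorem intTriCheck_of_intTriCheckUnit {n : ℕ} {A : ℕ → ℕ → ℤ} {rows : List (List (ℕ × ℤ))}
    {piv : List ℕ} (h : intTriCheckUnit n A rows piv = true) : intTriCheck n A rows piv = true :=
  (intTriCheckUnit_spec h).1

section Sound

variable {F : Type*} [Field F] {m κ : Type*}

/-- **Soundness of unit-pivot integer row certificates, in every characteristic.** If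
`intTriCheckUnit n A rows piv` succeeds for the integer presentation `A r c = M (fr r) (fc c)` of an
integer matrix `M`, then `n ≤ rank M` over EVERY field `F` (the diagonal entries `±1` of the
triangular matrix `P · M` stay non-zero in `F`, the sub-diagonal zeros stay zero). [folklore] -/
theorem le_rank_of_intTriCheckUnit [Fintype m] [Fintype κ] [DecidableEq m]
    (M : Matrix m κ ℤ) (fr : ℕ → m) (fc : ℕ → κ) {n : ℕ} {rows : List (List (ℕ × ℤ))}
    {piv : List ℕ} (h : intTriCheckUnit n (fun r c => M (fr r) (fc c)) rows piv = true) :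
    n ≤ (M.map (Int.cast : ℤ → F)).rank := by
  classical
  obtain ⟨htri, hunit⟩ := intTriCheckUnit_spec h
  set P : Matrix (Fin n) m F := fun a => intCertRow fr (rows.getD a []) with hP
  have hPA : ∀ (a : Fin n) (b : ℕ), (P * M.map (Int.cast : ℤ → F)) a (fc (piv.getD b 0)) =
      (intCertVal (fun r c => M (fr r) (fc c)) rows piv a b : F) := by
    intro a b
    rw [Matrix.mul_apply]
    simp only [hP, Matrix.map_apply]
    rw [sum_intCertRow_mul fr (fun i => M i (fc (piv.getD b 0))) (rows.getD a [])]
    rfl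
  have key := card_le_rank_of_keyTriangular_mul (M.map (Int.cast : ℤ → F)) P
    (fun a : Fin n => fc (piv.getD a 0)) (fun a : Fin n => (a : ℕ)) Fin.val_injective
    (fun a => by
      rw [hPA a a]
      rcases Int.natAbs_eq_iff.1 (hunit a a.2) with h1 | h1
      · rw [h1]; simp
      · rw [h1]; simp)
    (fun a b hba => by
      rw [hPA a b, (intTriCheck_spec htri a.2 b.2).1 hba, Int.cast_zero])
  simpa using key

end Sound

end Literature.LinearAlgebra.Matrix
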